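import Summits.RiemannHypothesis.RiemannHypothesis.Theorems.Splittings.PolyDoorLaguerre
import Summits.RiemannHypothesis.RiemannHypothesis.Theorems.Splittings.PolyDoorNegative

/-!
# LINE L13 «DBR POLYNOMIAL DOOR» — TARGET: the polynomial door dichotomy

Cell rh-split, route `DeBrangesSuzukiDoor`, item `stmt-RiemannHypothesis-21501` (`PolyDoorDichotomy`, the line's
TARGET; registrar rh-split-dbr-neg g16).  For a real polynomial `p ≠ 0`: the door `E_p = p_ℂ + i·p_ℂ′` has no
zero in the open upper half-plane **iff** every complex root of `p` is real — the polynomial shadow (`h = 0`)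
of «door zero-free ⟺ Laguerre–Pólya» (card SPLIT-dbr-neg §20, COROLLARY M).  PORT of the registrar's glue
`dichotomy_of_nodes` (skeleton `LineDbrB0.lean` fbf1fd8c172cea0f) onto the landed by-value nodes
`polyDoorLaguerre` (node 2, item 21497: real-rooted ⟹ zero-free) and `polyDoorNegative` (node 5, item 21500:
a non-real root ⟹ a zero in `ℂ₊`).

Proved BY VALUE (the item's `payload.signature` verbatim; the route file does not yet declare the decl).
Classical (Hermite–Biehler / Laguerre for `(p, p′)`: Levin 1964 ch. VII; arXiv:math/0607640 Thm 3.6);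
E-GENERAL, RH-free.  This is a RECORD line: RH is NOT proved by this, nor approached.
HONEST LABEL: known mathematics, 0 summit credit; nothing here bears on the truth of RH.
-/

set_option linter.dupNamespace false

namespace Summit.RiemannHypothesis.RiemannHypothesis.Theorems.Splittings.PolyDoorDichotomy

open Polynomial
open Summit.RiemannHypothesis.RiemannHypothesis.Theorems.Splittings.PolyDoorLaguerre (polyDoorLaguerre)
open Summit.RiemannHypothesis.RiemannHypothesis.Theorems.Splittings.PolyDoorNegative (polyDoorNegative)

/-- **TARGET of LINE L13 (item `stmt-RiemannHypothesis-21501`, `PolyDoorDichotomy` by value).**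
For a real polynomial `p ≠ 0`, `E_p = p_ℂ + i p_ℂ′` is zero-free on the open upper half-plane iff every
complex root of `p` is real.  Port of the registrar's glue `dichotomy_of_nodes` onto nodes 2 and 5. [folklore]
(Hermite–Biehler / Laguerre for `(p, p′)`; Levin, *Distribution of zeros of entire functions*, ch. VII.) -/
theorem polyDoorDichotomy :
    ∀ p : Polynomial ℝ, p ≠ 0 → ((∀ z : ℂ, 0 < z.im → (p.map (algebraMap ℝ ℂ) + Polynomial.C Complex.I *
      Polynomial.derivative (p.map (algebraMap ℝ ℂ))).eval z ≠ 0) ↔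
      (∀ z : ℂ, (p.map (algebraMap ℝ ℂ)).eval z = 0 → z.im = 0)) := by
  intro p hp
  constructor
  · intro hfree z hz
    by_contra him
    obtain ⟨w, hw, hwroot⟩ := polyDoorNegative p hp ⟨z, him, hz⟩
    exact hfree w hw hwroot
  · exact polyDoorLaguerre p hp

end Summit.RiemannHypothesis.RiemannHypothesis.Theorems.Splittings.PolyDoorDichotomy
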